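import Summits.CriticalPhenomena.CardyFormulaZ2.Theses.CardyQContinuation
import Summits.CriticalPhenomena.CardyFormulaZ2.Theorems.DyadicBetaRigidityDyadicBetaSufficesDilation

/-!
# Crux `IsingJetsConformal`, sub-goal `stub_higherJetCovariance_scaling`: exact homothety
# covariance of the self-dual FK crossing ratio `P_δ` and of its `s`-jets (route
# `CardyQContinuation`, item stmt-CriticalPhenomena-5560)

The route's inline self-dual random-cluster crossing ratio of a conformal rectangle
`R = (Ω; A = R.arc 0, B = R.arc 2)` at mesh `δ` is `P_δ(s) = N_δ(s) / Z_δ(s)`,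
`Z_δ(s) = Σᶠ_{ω ⊆ E(Ω_δ)} s^(|ω| + 2 k_B(ω))`, `N_δ(s)` the same sum restricted to Smirnov's crossing
event `C_δ(Ω; A, B)` (`discreteCrossing`), `k_B(ω)` the number of connected components of
`(openGraph ω ⊔ wired ((A)_δ ∪ (B)_δ)).induce Ω_δ` (discretisation `meshDomain` /
`discreteDomainGraph` / `discreteArc` of `DomainDiscretisation.lean`).

Stub 3b of the line (`stub_higherJetCovariance`, new mathematics in general) asserts that the
`δ → 0⁺` limits of the `s`-jets of `P_δ` at `s = √2` are invariant under conformal equivalences of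
marked rectangles. This file proves its exactly-provable lattice core for the homotheties
`z ↦ c z`, `c > 0`: the discretisation of `cΩ` at mesh `δ` IS the discretisation of `Ω` at mesh
`δ / c` — same site sets, same graph, same discrete arcs, same crossing event
(`DyadicLattice.meshDomain_smul`, `discreteDomainGraph_smul`, `discreteArc_smul`,
`discreteCrossing_smul` of `DyadicBetaRigidityDyadicBetaSufficesDilation.lean`, imported, not
restated) — so

* `ScalingCovariance.crossingRatio_smul` / `crossingRatio_image_mul_left`:
  `P_δ(cΩ; cA, cB)(s) = P_{δ/c}(Ω; A, B)(s)` for every `δ` and every complex `s`;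
* `stub_higherJetCovariance_scaling`: the registered sub-goal (set-level form, verbatim);
* `crossingRatio_imageUnivalent_mul_left`: the same for the route's `P` and the homothetic
  conformal rectangle `cR = R.imageUnivalent (z ↦ c z)` (`carrier_imageUnivalent`,
  `arc_imageUnivalent`): `P (cR) δ s = P R (δ / c) s`;
* `tendsto_iteratedDeriv_crossingRatio_imageUnivalent_mul_left_iff`: hence for every `n` and `L`
  the `n`-th `s`-jet of `P_δ(cR)` at `√2` tends to `L` as `δ → 0⁺` iff that of `P_δ(R)` does
  (`δ ↦ δ / c` maps `𝓝[>] 0` onto itself), and the jet limits, when they exist, coincide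
  (`jetLimit_eq_of_imageUnivalent_mul_left`, the homothety case of stub 3b; also the transfer of
  existence, `exists_jetLimit_imageUnivalent_mul_left_iff`, the homothety case of stub 2's
  rectangle dependence).

Everything is exact (all `δ`, all `s ∈ ℂ`); no named fact is used.

References: S. Smirnov, *Critical percolation in the plane*, C. R. Acad. Sci. Paris 333 (2001), §2
(the discretisation); G. Grimmett, *The Random-Cluster Model* (2006), §4.3.
-/

open scoped Pointwise Topology

namespace Summit.CriticalPhenomena.CardyFormulaZ2.Theorems.CardyQContinuation

open Set Filter
open Literature.Probability.LatticeModels Literature.Probability.Percolation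
open Literature.Probability.RandomPlanarGeometry

namespace ScalingCovariance

/-! ### Rescaling the mesh parameter along `𝓝[>] 0` -/

/-- `δ ↦ c δ` maps `0⁺` to `0⁺` for `c > 0`. [folklore] -/
theorem meshParam_mul_tendsto_nhdsGT_zero {c : ℝ} (hc : 0 < c) :
    Tendsto (fun δ : ℝ ↦ c * δ) (𝓝[>] 0) (𝓝[>] 0) := by
  have h : Tendsto (fun δ : ℝ ↦ c * δ) (𝓝 0) (𝓝 (c * 0)) := (continuous_const_mul c).tendsto 0
  rw [mul_zero] at h
  refine tendsto_nhdsWithin_of_tendsto_nhds_of_eventually_within _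
    (h.mono_left nhdsWithin_le_nhds) ?_
  filter_upwards [self_mem_nhdsWithin] with δ hδ
  exact mul_pos hc hδ

/-- `δ ↦ δ / c` maps `0⁺` to `0⁺` for `c > 0`. [folklore] -/
theorem meshParam_div_tendsto_nhdsGT_zero {c : ℝ} (hc : 0 < c) :
    Tendsto (fun δ : ℝ ↦ δ / c) (𝓝[>] 0) (𝓝[>] 0) := by
  simp only [div_eq_inv_mul]
  exact meshParam_mul_tendsto_nhdsGT_zero (inv_pos.2 hc)

/-- **Change of mesh variable `δ ↦ δ / c` along `δ → 0⁺`** (`c > 0`): `g (δ / c) → l` iff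
`g δ → l`. [folklore] -/
theorem tendsto_comp_div_const_nhdsGT_zero_iff {α : Type*} {c : ℝ} (hc : 0 < c) (g : ℝ → α)
    (l : Filter α) : Tendsto (fun δ ↦ g (δ / c)) (𝓝[>] 0) l ↔ Tendsto g (𝓝[>] 0) l := by
  refine ⟨fun h ↦ ?_, fun h ↦ h.comp (meshParam_div_tendsto_nhdsGT_zero hc)⟩
  refine (h.comp (meshParam_mul_tendsto_nhdsGT_zero hc)).congr fun δ ↦ ?_
  simp only [Function.comp_apply, mul_div_cancel_left₀ δ hc.ne']

/-! ### Exact homothety covariance of the crossing ratio (set level) -/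

/-- **The self-dual FK crossing ratio is exactly dilation covariant** (set level, mesh `cδ`):
`P_{cδ}(cΩ; cA, cB)(s) = P_δ(Ω; A, B)(s)` for all `δ` and all complex `s` — the discrete domain,
its graph, the discrete arcs and the crossing event of `cΩ` at mesh `cδ` are literally those of
`Ω` at mesh `δ`. [cite: Smirnov2001, §2] -/
theorem crossingRatio_smul {c : ℝ} (hc : 0 < c) (Ω A B : Set ℂ) (δ : ℝ) (s : ℂ) :
    (∑ᶠ ω ∈ 𝒫 (discreteDomainGraph ((c : ℂ) • Ω) (c * δ)).edgeSet,
        (discreteCrossing ((c : ℂ) • Ω) (c * δ) ((c : ℂ) • A) ((c : ℂ) • B)).indicator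
          (fun ω ↦ s ^ (ω.ncard + 2 * Nat.card ((openGraph ω ⊔ wired
            (discreteArc ((c : ℂ) • Ω) (c * δ) ((c : ℂ) • A) ∪
              discreteArc ((c : ℂ) • Ω) (c * δ) ((c : ℂ) • B))).induce
            (meshDomain ((c : ℂ) • Ω) (c * δ))).ConnectedComponent)) ω) /
      (∑ᶠ ω ∈ 𝒫 (discreteDomainGraph ((c : ℂ) • Ω) (c * δ)).edgeSet,
        s ^ (ω.ncard + 2 * Nat.card ((openGraph ω ⊔ wired
          (discreteArc ((c : ℂ) • Ω) (c * δ) ((c : ℂ) • A) ∪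
            discreteArc ((c : ℂ) • Ω) (c * δ) ((c : ℂ) • B))).induce
          (meshDomain ((c : ℂ) • Ω) (c * δ))).ConnectedComponent)) =
    (∑ᶠ ω ∈ 𝒫 (discreteDomainGraph Ω δ).edgeSet,
        (discreteCrossing Ω δ A B).indicator
          (fun ω ↦ s ^ (ω.ncard + 2 * Nat.card ((openGraph ω ⊔ wired
            (discreteArc Ω δ A ∪ discreteArc Ω δ B)).induce
            (meshDomain Ω δ)).ConnectedComponent)) ω) /
      (∑ᶠ ω ∈ 𝒫 (discreteDomainGraph Ω δ).edgeSet,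
        s ^ (ω.ncard + 2 * Nat.card ((openGraph ω ⊔ wired
          (discreteArc Ω δ A ∪ discreteArc Ω δ B)).induce (meshDomain Ω δ)).ConnectedComponent)) := by
  rw [DyadicLattice.discreteCrossing_smul hc, DyadicLattice.discreteArc_smul hc,
    DyadicLattice.discreteArc_smul hc, DyadicLattice.meshDomain_smul hc.ne',
    DyadicLattice.discreteDomainGraph_smul hc.ne']

/-- **The self-dual FK crossing ratio is exactly dilation covariant** (set level, mesh `δ`,
homothety written as an image): `P_δ(cΩ; cA, cB)(s) = P_{δ/c}(Ω; A, B)(s)` for all `δ` and all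
complex `s`. [cite: Smirnov2001, §2] -/
theorem crossingRatio_image_mul_left {c : ℝ} (hc : 0 < c) (Ω A B : Set ℂ) (δ : ℝ) (s : ℂ) :
    (∑ᶠ ω ∈ 𝒫 (discreteDomainGraph ((fun z : ℂ ↦ (c : ℂ) * z) '' Ω) δ).edgeSet,
        (discreteCrossing ((fun z : ℂ ↦ (c : ℂ) * z) '' Ω) δ ((fun z : ℂ ↦ (c : ℂ) * z) '' A)
            ((fun z : ℂ ↦ (c : ℂ) * z) '' B)).indicator
          (fun ω ↦ s ^ (ω.ncard + 2 * Nat.card ((openGraph ω ⊔ wired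
            (discreteArc ((fun z : ℂ ↦ (c : ℂ) * z) '' Ω) δ ((fun z : ℂ ↦ (c : ℂ) * z) '' A) ∪
              discreteArc ((fun z : ℂ ↦ (c : ℂ) * z) '' Ω) δ
                ((fun z : ℂ ↦ (c : ℂ) * z) '' B))).induce
            (meshDomain ((fun z : ℂ ↦ (c : ℂ) * z) '' Ω) δ)).ConnectedComponent)) ω) /
      (∑ᶠ ω ∈ 𝒫 (discreteDomainGraph ((fun z : ℂ ↦ (c : ℂ) * z) '' Ω) δ).edgeSet,
        s ^ (ω.ncard + 2 * Nat.card ((openGraph ω ⊔ wired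
          (discreteArc ((fun z : ℂ ↦ (c : ℂ) * z) '' Ω) δ ((fun z : ℂ ↦ (c : ℂ) * z) '' A) ∪
            discreteArc ((fun z : ℂ ↦ (c : ℂ) * z) '' Ω) δ
              ((fun z : ℂ ↦ (c : ℂ) * z) '' B))).induce
          (meshDomain ((fun z : ℂ ↦ (c : ℂ) * z) '' Ω) δ)).ConnectedComponent)) =
    (∑ᶠ ω ∈ 𝒫 (discreteDomainGraph Ω (δ / c)).edgeSet,
        (discreteCrossing Ω (δ / c) A B).indicator
          (fun ω ↦ s ^ (ω.ncard + 2 * Nat.card ((openGraph ω ⊔ wired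
            (discreteArc Ω (δ / c) A ∪ discreteArc Ω (δ / c) B)).induce
            (meshDomain Ω (δ / c))).ConnectedComponent)) ω) /
      (∑ᶠ ω ∈ 𝒫 (discreteDomainGraph Ω (δ / c)).edgeSet,
        s ^ (ω.ncard + 2 * Nat.card ((openGraph ω ⊔ wired
          (discreteArc Ω (δ / c) A ∪ discreteArc Ω (δ / c) B)).induce
          (meshDomain Ω (δ / c))).ConnectedComponent)) := by
  obtain ⟨δ, rfl⟩ : ∃ δ' : ℝ, δ = c * δ' := ⟨δ / c, (mul_div_cancel₀ δ hc.ne').symm⟩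
  rw [mul_div_cancel_left₀ δ hc.ne', ← DyadicLattice.smul_set_eq_image,
    ← DyadicLattice.smul_set_eq_image, ← DyadicLattice.smul_set_eq_image]
  exact crossingRatio_smul hc Ω A B δ s

end ScalingCovariance

open ScalingCovariance

/-- **Sub-goal `stub_higherJetCovariance_scaling` (homothety covariance, exact)** of stub 3b of the
skeleton of the crux `IsingJetsConformal` (stmt-CriticalPhenomena-5560): for all sets
`Ω, A, B ⊆ ℂ`, every `c > 0`, every mesh `δ` and every complex `s`, the inline self-dual FK
crossing ratio of `(cΩ; cA, cB)` at mesh `δ` equals that of `(Ω; A, B)` at mesh `δ / c` — the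
discretisation of `cΩ` at mesh `δ` is literally the discretisation of `Ω` at mesh `δ / c`.
[cite: Smirnov2001, §2] -/
theorem stub_higherJetCovariance_scaling : (let wΩ : Set ℂ → Set ℂ → Set ℂ → ℝ → ℂ → Set (Sym2 (Literature.Probability.LatticeModels.Site 2)) → ℂ := fun Ω A B δ s ω ↦ s ^ (ω.ncard + 2 * Nat.card ((Literature.Probability.Percolation.openGraph ω ⊔ Literature.Probability.LatticeModels.wired (Literature.Probability.LatticeModels.discreteArc Ω δ A ∪ Literature.Probability.LatticeModels.discreteArc Ω δ B)).induce (Literature.Probability.LatticeModels.meshDomain Ω δ)).ConnectedComponent); let PΩ : Set ℂ → Set ℂ → Set ℂ → ℝ → ℂ → ℂ := fun Ω A B δ s ↦ (∑ᶠ ω ∈ 𝒫 (Literature.Probability.LatticeModels.discreteDomainGraph Ω δ).edgeSet, (Literature.Probability.Percolation.discreteCrossing Ω δ A B).indicator (wΩ Ω A B δ s) ω) / (∑ᶠ ω ∈ 𝒫 (Literature.Probability.LatticeModels.discreteDomainGraph Ω δ).edgeSet, wΩ Ω A B δ s ω); ∀ (Ω A B : Set ℂ) (c : ℝ), 0 <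 c → ∀ (δ : ℝ) (s : ℂ), PΩ ((fun z : ℂ ↦ (c : ℂ) * z) '' Ω) ((fun z : ℂ ↦ (c : ℂ) * z) '' A) ((fun z : ℂ ↦ (c : ℂ) * z) '' B) δ s = PΩ Ω A B (δ / c) s) := by
  dsimp only
  intro Ω A B c hc δ s
  exact crossingRatio_image_mul_left hc Ω A B δ s

/-! ### Corollaries for conformal rectangles: the homothetic rectangle `cR` -/

/-- **Homothety covariance of the route's `P`**: for a conformal rectangle `R`, `c > 0` and the
homothetic rectangle `cR = R.imageUnivalent (z ↦ c z)` (carrier `cΩ`, arcs `c (R.arc i)`), the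
route's inline self-dual FK crossing ratio satisfies `P (cR) δ s = P R (δ / c) s` for every mesh
`δ` and every complex `s`. [cite: Smirnov2001, §2] -/
theorem crossingRatio_imageUnivalent_mul_left {c : ℝ} (R : ConformalRectangle) (hc : 0 < c)
    {hd : DifferentiableOn ℂ (fun z : ℂ ↦ (c : ℂ) * z) (closure R.carrier)}
    {hi : InjOn (fun z : ℂ ↦ (c : ℂ) * z) (closure R.carrier)} (δ : ℝ) (s : ℂ) :
    (let w : Literature.Probability.RandomPlanarGeometry.ConformalRectangle → ℝ → ℂ → Set (Sym2 (Literature.Probability.LatticeModels.Site 2)) → ℂ := fun R δ s ω ↦ s ^ (ω.ncard + 2 * Nat.card ((Literature.Probability.Percolation.openGraph ω ⊔ Literature.Probability.LatticeModels.wired (Literature.Probability.LatticeModels.discreteArc R.carrier δ (R.arc 0) ∪ Literature.Probability.LatticeModels.discreteArc R.carrier δ (R.arc 2))).induce (Literature.Probability.LatticeModels.meshDomain R.carrier δ)).ConnectedComponent); let P : Literature.Probability.RandomPlanarGeometry.ConformalRectangle → ℝ → ℂ → ℂ := fun R δ s ↦ (∑ᶠ ω ∈ 𝒫 (Literature.Probability.LatticeModels.discreteDomainGraph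 R.carrier δ).edgeSet, (Literature.Probability.Percolation.discreteCrossing R.carrier δ (R.arc 0) (R.arc 2)).indicator (w R δ s) ω) / (∑ᶠ ω ∈ 𝒫 (Literature.Probability.LatticeModels.discreteDomainGraph R.carrier δ).edgeSet, w R δ s ω); P (R.imageUnivalent (fun z : ℂ ↦ (c : ℂ) * z) hd hi) δ s = P R (δ / c) s) := by
  dsimp only
  rw [MarkedDomain.carrier_imageUnivalent, MarkedDomain.arc_imageUnivalent,
    MarkedDomain.arc_imageUnivalent]
  exact crossingRatio_image_mul_left hc R.carrier (R.arc 0) (R.arc 2) δ s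

/-- **Transfer of jet convergence under homotheties**: for every `n` and `L`, the `n`-th `s`-jet of
`P_δ(cR)` at `s = √2` tends to `L` as `δ → 0⁺` iff the `n`-th `s`-jet of `P_δ(R)` at `√2` does
(`P (cR) δ = P R (δ / c)` as functions of `s`, and `δ ↦ δ / c` maps `𝓝[>] 0` onto itself).
[cite: Smirnov2001, §2] -/
theorem tendsto_iteratedDeriv_crossingRatio_imageUnivalent_mul_left_iff {c : ℝ}
    (R : ConformalRectangle) (hc : 0 < c)
    {hd : DifferentiableOn ℂ (fun z : ℂ ↦ (c : ℂ) * z) (closure R.carrier)}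
    {hi : InjOn (fun z : ℂ ↦ (c : ℂ) * z) (closure R.carrier)} (n : ℕ) (L : ℂ) :
    (let w : Literature.Probability.RandomPlanarGeometry.ConformalRectangle → ℝ → ℂ → Set (Sym2 (Literature.Probability.LatticeModels.Site 2)) → ℂ := fun R δ s ω ↦ s ^ (ω.ncard + 2 * Nat.card ((Literature.Probability.Percolation.openGraph ω ⊔ Literature.Probability.LatticeModels.wired (Literature.Probability.LatticeModels.discreteArc R.carrier δ (R.arc 0) ∪ Literature.Probability.LatticeModels.discreteArc R.carrier δ (R.arc 2))).induce (Literature.Probability.LatticeModels.meshDomain R.carrier δ)).ConnectedComponent); let P : Literature.Probability.RandomPlanarGeometry.ConformalRectangle → ℝ → ℂ → ℂ := fun R δ s ↦ (∑ᶠ ω ∈ 𝒫 (Literature.Probability.LatticeModels.discreteDomainGraph R.carrier δ).edgeSet, (Literature.Probability.Percolation.discreteCrossing R.carrier δ (R.arc 0) (R.arc 2)).indicator (w R δ s) ω) / (∑ᶠ ω ∈ 𝒫 (Literature.Probability.LatticeModels.discreteDomainGraph R.carrier δ).edgeSet, w R δ s ω); (Filter.Tendsto (fun δ ↦ iteratedDeriv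 n (P (R.imageUnivalent (fun z : ℂ ↦ (c : ℂ) * z) hd hi) δ) (Real.sqrt 2 : ℂ)) (nhdsWithin 0 (Set.Ioi 0)) (nhds L) ↔ Filter.Tendsto (fun δ ↦ iteratedDeriv n (P R δ) (Real.sqrt 2 : ℂ)) (nhdsWithin 0 (Set.Ioi 0)) (nhds L))) := by
  intro w P
  have hP : ∀ δ : ℝ, P (R.imageUnivalent (fun z : ℂ ↦ (c : ℂ) * z) hd hi) δ = P R (δ / c) :=
    fun δ ↦ funext fun s ↦ crossingRatio_imageUnivalent_mul_left R hc δ s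
  simp only [hP]
  exact tendsto_comp_div_const_nhdsGT_zero_iff hc
    (fun δ ↦ iteratedDeriv n (P R δ) (Real.sqrt 2 : ℂ)) (nhds L)

/-- **Transfer of the existence of jet limits under homotheties** (the homothety case of the
rectangle dependence in stub 2): the `n`-th `s`-jet of `P_δ(cR)` at `√2` converges as `δ → 0⁺` iff
that of `P_δ(R)` does. [cite: Smirnov2001, §2] -/
theorem exists_jetLimit_imageUnivalent_mul_left_iff {c : ℝ} (R : ConformalRectangle) (hc : 0 < c)
    {hd : DifferentiableOn ℂ (fun z : ℂ ↦ (c : ℂ) * z) (closure R.carrier)}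
    {hi : InjOn (fun z : ℂ ↦ (c : ℂ) * z) (closure R.carrier)} (n : ℕ) :
    (let w : Literature.Probability.RandomPlanarGeometry.ConformalRectangle → ℝ → ℂ → Set (Sym2 (Literature.Probability.LatticeModels.Site 2)) → ℂ := fun R δ s ω ↦ s ^ (ω.ncard + 2 * Nat.card ((Literature.Probability.Percolation.openGraph ω ⊔ Literature.Probability.LatticeModels.wired (Literature.Probability.LatticeModels.discreteArc R.carrier δ (R.arc 0) ∪ Literature.Probability.LatticeModels.discreteArc R.carrier δ (R.arc 2))).induce (Literature.Probability.LatticeModels.meshDomain R.carrier δ)).ConnectedComponent); let P : Literature.Probability.RandomPlanarGeometry.ConformalRectangle → ℝ → ℂ → ℂ := fun R δ s ↦ (∑ᶠ ω ∈ 𝒫 (Literature.Probability.LatticeModels.discreteDomainGraph R.carrier δ).edgeSet, (Literature.Probability.Percolation.discreteCrossing R.carrier δ (R.arc 0) (R.arc 2)).indicator (w R δ s) ω) / (∑ᶠ ω ∈ 𝒫 (Literature.Probability.LatticeModels.discreteDomainGraph R.carrier δ).edgeSet, w R δ s ω); ((∃ L : ℂ, Filter.Tendsto (fun δ ↦ iteratedDeriv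 n (P (R.imageUnivalent (fun z : ℂ ↦ (c : ℂ) * z) hd hi) δ) (Real.sqrt 2 : ℂ)) (nhdsWithin 0 (Set.Ioi 0)) (nhds L)) ↔ ∃ L : ℂ, Filter.Tendsto (fun δ ↦ iteratedDeriv n (P R δ) (Real.sqrt 2 : ℂ)) (nhdsWithin 0 (Set.Ioi 0)) (nhds L))) := by
  intro w P
  exact exists_congr fun L ↦
    tendsto_iteratedDeriv_crossingRatio_imageUnivalent_mul_left_iff R hc (hd := hd) (hi := hi) n L

/-- **The homothety case of stub 3b (`stub_higherJetCovariance`)**: for every `n`, if the `n`-th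
`s`-jets at `√2` of `P_δ(R)` and of `P_δ(cR)` (`cR = R.imageUnivalent (z ↦ c z)`, `c > 0`) tend to
`L` and `L'` respectively as `δ → 0⁺`, then `L = L'`. [cite: Smirnov2001, §2] -/
theorem jetLimit_eq_of_imageUnivalent_mul_left {c : ℝ} (R : ConformalRectangle) (hc : 0 < c)
    {hd : DifferentiableOn ℂ (fun z : ℂ ↦ (c : ℂ) * z) (closure R.carrier)}
    {hi : InjOn (fun z : ℂ ↦ (c : ℂ) * z) (closure R.carrier)} (n : ℕ) (L L' : ℂ) :
    (let w : Literature.Probability.RandomPlanarGeometry.ConformalRectangle → ℝ → ℂ → Set (Sym2 (Literature.Probability.LatticeModels.Site 2)) → ℂ := fun R δ s ω ↦ s ^ (ω.ncard + 2 * Nat.card ((Literature.Probability.Percolation.openGraph ω ⊔ Literature.Probability.LatticeModels.wired (Literature.Probability.LatticeModels.discreteArc R.carrier δ (R.arc 0) ∪ Literature.Probability.LatticeModels.discreteArc R.carrier δ (R.arc 2))).induce (Literature.Probability.LatticeModels.meshDomain R.carrier δ)).ConnectedComponent); let P : Literature.Probability.RandomPlanarGeometry.ConformalRectangle → ℝ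 → ℂ → ℂ := fun R δ s ↦ (∑ᶠ ω ∈ 𝒫 (Literature.Probability.LatticeModels.discreteDomainGraph R.carrier δ).edgeSet, (Literature.Probability.Percolation.discreteCrossing R.carrier δ (R.arc 0) (R.arc 2)).indicator (w R δ s) ω) / (∑ᶠ ω ∈ 𝒫 (Literature.Probability.LatticeModels.discreteDomainGraph R.carrier δ).edgeSet, w R δ s ω); Filter.Tendsto (fun δ ↦ iteratedDeriv n (P R δ) (Real.sqrt 2 : ℂ)) (nhdsWithin 0 (Set.Ioi 0)) (nhds L) → Filter.Tendsto (fun δ ↦ iteratedDeriv n (P (R.imageUnivalent (fun z : ℂ ↦ (c : ℂ) * z) hd hi) δ) (Real.sqrt 2 : ℂ)) (nhdsWithin 0 (Set.Ioi 0)) (nhds L') → L = L') := by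
  intro w P hL hL'
  exact tendsto_nhds_unique hL
    ((tendsto_iteratedDeriv_crossingRatio_imageUnivalent_mul_left_iff R hc (hd := hd) (hi := hi)
      n L').1 hL')

end Summit.CriticalPhenomena.CardyFormulaZ2.Theorems.CardyQContinuation
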